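import Mathlib
import HarnessLib
import Summits.HubbardSuperconductivity.HubbardSuperconductivity.Theorems.KLProgrammeMatsubaraSliceBubbleWindow
import Summits.HubbardSuperconductivity.HubbardSuperconductivity.Theorems.KLProgrammeMatsubaraSliceBubbleTransferQuasi

/-!
# Route `KLProgramme` — ENGINE stmt-HubbardSuperconductivity-20437 `KLRegimeEngineV17F2`, row (c) value lane: the WINDOW form of the same-slice bubble at transfer with a
# QUASI-LIPSCHITZ insertion (brick 3′-4 of cure (A″) of located «(c)-OUT-COOPER-ANTIPODE», route 3′; cell gate-hubbard-kl, seat hubbard-kl-k3c2-p2 g25)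

WHY.  Sequel of `…SliceBubbleTransferQuasi` (brick 3′-3): `klsw_slice_bubble_transfer_norm_le` (…SliceBubbleWindow — insertion and shift only known on the window
`[−4Λₙ, 4Λₙ]`, clamp) with `‖W(e) − W(0)‖ ≤ L_W|e| + δ_W`; conclusion + `(131072/π)(ℓ + 8M_F)·δ_W`.  This is the lemma `klfb_ray_bubble_norm_le_tube` calls; its quasi twin
(…ForwardBubbleRayTube successor) swaps this call.
* **`klsw_slice_bubble_transfer_norm_le_quasi`**.
Pure analysis (the landed proof with one call swapped); nothing about the model is asserted.  0 kit · 0 lit.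
-/

noncomputable section

namespace Summit.HubbardSuperconductivity.HubbardSuperconductivity.Theorems.KLRegimeSplit

set_option linter.dupNamespace false -- summit = problem name (single-conjunct summit), D-0017

open Real Set MeasureTheory Complex Literature.MathematicalPhysics.QuantumLattice Literature.Probability.LatticeModels
open Summit.HubbardSuperconductivity.HubbardSuperconductivity.Theorems.KLProgrammeLegKernels

section Window

variable {F f f' : ℝ → ℂ} {LF MF ℓ Mf Lf' Mf' ℓ' : ℝ} {W : ℝ → ℂ} {δ : ℝ → ℝ} {LW BW δmax : ℝ}

/-- **`klsp_slice_bubble_transfer_norm_le_quasi` with the insertion and the energy shift only known ON THE WINDOW `[−4Λₙ, 4Λₙ]`** (quasi-Lipschitz insertion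
`‖W(e) − W(0)‖ ≤ L_W|e| + δ_W` there). -/
theorem klsw_slice_bubble_transfer_norm_le_quasi {Lf LWr δW : ℝ}
    (hlip : ∀ s s', ‖f s - f s'‖ ≤ Lf * |s - s'|) (hbd : ∀ s, ‖f s‖ ≤ Mf) {n : ℕ}
    (hin : ∀ s, s ≤ (klScale klE0 n / 2) ^ 2 → f s = 0) (hout : ∀ s, (4 * klScale klE0 n) ^ 2 ≤ s → f s = 0)
    (hlip' : ∀ s s', ‖f' s - f' s'‖ ≤ Lf' * |s - s'|) (hbd' : ∀ s, ‖f' s‖ ≤ Mf') (hLf' : Lf' ≤ ℓ' / klScale klE0 n ^ 2)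
    (hin' : ∀ s, s ≤ (klScale klE0 n / 2) ^ 2 → f' s = 0) (hout' : ∀ s, (4 * klScale klE0 n) ^ 2 ≤ s → f' s = 0)
    (hMF : 0 ≤ MF) (hFlip : ∀ s s', ‖f s * f' s - f s' * f' s'‖ ≤ LF * |s - s'|) (hFbd : ∀ s, ‖f s * f' s‖ ≤ MF)
    (hLF : LF ≤ ℓ / klScale klE0 n ^ 2)
    (hW : ContinuousOn W (Icc (-(4 * klScale klE0 n)) (4 * klScale klE0 n))) (hLW : 0 ≤ LWr) (hδW : 0 ≤ δW) (hBW : 0 ≤ BW)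
    (hWlip : ∀ e : ℝ, |e| < 4 * klScale klE0 n → ‖W e - W 0‖ ≤ LWr * |e| + δW)
    (hWbd : ∀ e, |e| < 4 * klScale klE0 n → ‖W e‖ ≤ BW)
    (hδc : ContinuousOn δ (Icc (-(4 * klScale klE0 n)) (4 * klScale klE0 n))) (hδ0 : 0 ≤ δmax)
    (hδ : ∀ e, |e| ≤ 4 * klScale klE0 n → |δ e| ≤ δmax)
    (q₀ : ℝ) {β : ℝ} (hβ : klBetaMin ≤ β) (hn : n ≤ nScales β + 1) {M : ℕ}
    (hM : β * (4 * klScale klE0 n) / (2 * Real.pi) + 1 ≤ M) :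
    ‖β⁻¹ • ∑ i : MatsubaraIdx M, ∫ e,
        W e * (f (matsubaraFreq β M i ^ 2 + e ^ 2) / (((matsubaraFreq β M i ^ 2 + e ^ 2 : ℝ)) : ℂ) * (I * (matsubaraFreq β M i) + e)) *
          (f' ((matsubaraFreq β M i + q₀) ^ 2 + (e + δ e) ^ 2) / ((((matsubaraFreq β M i + q₀) ^ 2 + (e + δ e) ^ 2 : ℝ)) : ℂ) *
              (I * ((matsubaraFreq β M i + q₀ : ℝ) : ℂ) + ((e + δ e : ℝ) : ℂ)))‖ ≤
      524288 / Real.pi * (ℓ + 8 * MF) * LWr * klScale klE0 n + 131072 / Real.pi * (ℓ + 8 * MF) * δW +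
        393216 / Real.pi * (ℓ + 8 * MF) * BW * ((Real.pi / β) / klScale klE0 n) +
          1024 / Real.pi * Mf * (48 * ℓ' + 193 * Mf') * BW * (|q₀| + δmax) / klScale klE0 n := by
  set r := 4 * klScale klE0 n with hr_def
  have hΛ := klth_klScale_pos n
  have hr : 0 ≤ r := by positivity
  set W' : ℝ → ℂ := fun e => W (max (-r) (min r e)) with hW'
  set δ' : ℝ → ℝ := fun e => δ (max (-r) (min r e)) with hδ'
  have hW'c : Continuous W' := klsw_continuous_comp_clamp hr hW
  have hδ'c : Continuous δ' := klsw_continuous_comp_clamp hr hδc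
  have hW'eq : ∀ e, |e| < r → W' e = W e := fun e he => by simp only [hW', Literature.Analysis.FunctionSpaces.max_neg_min_eq_self he.le]
  have hδ'eq : ∀ e, |e| < r → δ' e = δ e := fun e he => by simp only [hδ', Literature.Analysis.FunctionSpaces.max_neg_min_eq_self he.le]
  have hW'0 : W' 0 = W 0 := by simp only [hW', Literature.Analysis.FunctionSpaces.max_neg_min_eq_self (show |(0:ℝ)| ≤ r by simpa using hr)]
  have hW'lip : ∀ e : ℝ, |e| < r → ‖W' e - W' 0‖ ≤ LWr * |e| + δW := fun e he => by rw [hW'eq e he, hW'0]; exact hWlip e he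
  have hW'bd : ∀ e : ℝ, |e| < r → ‖W' e‖ ≤ BW := fun e he => by rw [hW'eq e he]; exact hWbd e he
  have hδ'bd : ∀ e, |δ' e| ≤ δmax := by
    intro e
    have hm := klsw_clamp_mem hr e
    exact hδ _ (abs_le.mpr ⟨hm.1, hm.2⟩)
  -- the integrands agree pointwise (the first propagator vanishes off the window)
  have hΦzero : ∀ (k₀ e : ℝ), r ≤ |e| →
      f (k₀ ^ 2 + e ^ 2) / (((k₀ ^ 2 + e ^ 2 : ℝ)) : ℂ) * (I * k₀ + e) = 0 := by
    intro k₀ e he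
    rw [klsw_weight_zero_of_le_abs hΛ.le hout k₀ he, zero_div, zero_mul]
  have hpt : ∀ (k₀ e : ℝ),
      W e * (f (k₀ ^ 2 + e ^ 2) / (((k₀ ^ 2 + e ^ 2 : ℝ)) : ℂ) * (I * k₀ + e)) *
          (f' ((k₀ + q₀) ^ 2 + (e + δ e) ^ 2) / ((((k₀ + q₀) ^ 2 + (e + δ e) ^ 2 : ℝ)) : ℂ) *
            (I * ((k₀ + q₀ : ℝ) : ℂ) + ((e + δ e : ℝ) : ℂ))) =
        W' e * (f (k₀ ^ 2 + e ^ 2) / (((k₀ ^ 2 + e ^ 2 : ℝ)) : ℂ) * (I * k₀ + e)) *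
          (f' ((k₀ + q₀) ^ 2 + (e + δ' e) ^ 2) / ((((k₀ + q₀) ^ 2 + (e + δ' e) ^ 2 : ℝ)) : ℂ) *
            (I * ((k₀ + q₀ : ℝ) : ℂ) + ((e + δ' e : ℝ) : ℂ))) := by
    intro k₀ e
    by_cases he : |e| < r
    · rw [hW'eq e he, hδ'eq e he]
    · rw [hΦzero k₀ e (not_lt.mp he), mul_zero, zero_mul, mul_zero, zero_mul]
  simp_rw [hpt]
  exact klsp_slice_bubble_transfer_norm_le_quasi hlip hbd hin hout hlip' hbd' hLf' hin' hout' hMF hFlip hFbd hLF hW'c hLW hδW hBW hW'lip hW'bd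
    hδ'c hδ0 hδ'bd q₀ hβ hn hM

end Window

end Summit.HubbardSuperconductivity.HubbardSuperconductivity.Theorems.KLRegimeSplit

end
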